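import Summits.NavierStokesRegularity.FluidComputer.AmplitudeKnobBeable

/-!
# The amplitude knob of Tao's delay gate, part 4: Theorem 5.3 under a POLYNOMIAL amplitude threshold

Last part of `AmplitudeKnob{Fire,Douse,Beable}.lean` (cell `pub-fluidc`, blueprint seat bp1, gen 20; namespace
`Summit.NavierStokesRegularity.FluidComputer.AmplitudeKnob`). HONEST FRAMING (verbatim): low prior, high
value-of-information experiment on Tao's machine paradigm; NOT a claim that NS blows up. Everything concerns the
five-mode truncation (5.5) of [Tao2016AveragedNS, §5.5] in the retuned form `delayCircuitWith K M ε` started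
EXACTLY at (5.6); nothing is proved about Navier–Stokes.

MAIN RESULT (`transition_polyThreshold`). For `K ≥ K₀ = 2·20⁴²·42! + 16`, `3000 log K ≤ M ≤ K¹⁰` and
`0 < ε ≤ e^{-700·M·log K/K}/K¹⁸⁰⁰`, every trajectory of `delayCircuitWith K M ε` from `delayInit` has a critical
time `t_c` with `|t_c - √2| ≤ 24 log K/M`, is quiet (`a = 1 + O(K⁻¹⁰)`, rest `O(K⁻¹⁰)`, constant 200) on ALL of
`[0, t_c]`, and has fired (`ã = 1 + O(K⁻¹⁰)`, rest `O(K⁻¹⁰)`) for ALL `t ≥ t_c + 880 log K/M + 1/K + 300 log K/K`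
(`transition_polyThreshold_sqrt`: hence from the printed onset `t_c + 880 log K/M + 1/√K` on). This is
`Thm53With.transitionWith_explicit` with its amplitude threshold `e^{-10M}/K¹⁰⁰` replaced by
`e^{-700·M·log K/K}/K¹⁸⁰⁰`: the exponent loses a factor `K/(70 log K)`, and
* (`transition_linearAmplifier`) whenever `700·M·log K ≤ K` the threshold is the FIXED POWER `ε ≤ K⁻¹⁸⁰¹`,
  independent of the amplifier (the tree's `polySeedTransition` needs `K^{-(10p+100)}` for `M = p log K`);
* (`taoMember_polyPulse`) for Tao's own circuit (`M = K¹⁰`, `delayCircuitWith_pow_ten`) the certified threshold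
  improves from `e^{-10K¹⁰}/K¹⁰⁰` to `e^{-700K⁹log K}/K¹⁸⁰⁰`.
The abstract form `transition_of_pulse` isolates the one inequality that the amplitude must satisfy: the PULSE
HYPOTHESIS `64·M·ε²·e^{4M(T₀ - t_c)} ≤ K²⁰` at the delivery time `T₀ = t_c + 880 log K/M + 1/K + 300 log K/K`.

WHY (mechanism, parts 1–3): the printed proof keeps the clock `b ≥ ε/8` on the whole window `[t_c, 2]` by the
crude bound `c ≤ 2ε²e^{(5t-1)M}`, which costs `ε ≤ e^{-Θ(M)}`; but once the drain has delivered (time `T₀`) the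
output `ã` is monotone and `a² + b² + c² + d² = 1 - ã²` only decreases, so the clock has to survive the trigger
PULSE `c ≤ 2K⁻¹⁰ε²e^{2M(t-t_c)}` only up to `T₀`. REMARK (heuristic, NOT proved here): for `M ≫ K` some
smallness `ε ≤ K^{-Θ(M/K)}` is also NECESSARY for the conclusion as stated — the trigger is a pulse of duration
`Θ(log(1/ε)/M)` (the `(b,c)` subsystem rotates `b → -b` once `c` reaches `O(ε)`), and if it ends before the
`Θ(log K/K)` drain has delivered, the rotor stops at an uncontrolled `(a,d)` phase and the transfer to `ã` is
incomplete within the window. So `ε₁(K,M) = K^{-Θ(1 + M/K)}` is the true shape of Theorem 5.3's amplitude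
threshold for this family, up to the constants. [cite: Tao2016AveragedNS, Theorem 5.3, §5.5]. No named facts;
0 sorry.
-/

noncomputable section

namespace Summit.NavierStokesRegularity.FluidComputer.AmplitudeKnob

open Real Set Filter Topology
open Literature.Analysis.FluidPDE.Tao2016AveragedNS
open Literature.Analysis.FluidPDE.Tao2016AveragedNS.Thm53 (exists_hitTime invSqrt_facts init_c)
open Literature.Analysis.FluidPDE.Tao2016AveragedNS.Thm53With (continuous_traj log_facts tc_window
  abs_sub_sqrt_two_le able_window beable_of_sum_sq family_params window_fits)

/-! ## Numerics of the polynomial threshold -/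

/-- `e^{-M} ≤ K⁻¹⁰` once `10 log K ≤ M`. [folklore] -/
theorem exp_neg_le_inv_pow {K M : ℝ} (hK0 : 0 < K) (hM : 10 * Real.log K ≤ M) :
    exp (-M) ≤ 1 / K ^ 10 := by
  rw [one_div, ← Real.exp_log (pow_pos hK0 10), ← Real.exp_neg, Real.exp_le_exp, Real.log_pow]
  push_cast
  linarith

/-- (N4') for the drain time `L = 300 log K/K`: `2e^{-(K/10)L} = 2K⁻³⁰ ≤ K⁻²⁰`. [folklore] -/
theorem drain_numeric {K : ℝ} (hK : 16 ≤ K) :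
    2 * exp (-(K / 10 * (300 * Real.log K / K))) ≤ 1 / K ^ 20 := by
  have hK0 : 0 < K := by linarith
  have hKne : K ≠ 0 := hK0.ne'
  have h : K / 10 * (300 * Real.log K / K) = (30 : ℕ) * Real.log K := by
    push_cast; field_simp; ring
  rw [h, Real.exp_neg, Real.exp_nat_mul, Real.exp_log hK0, ← one_div, mul_one_div,
    div_le_div_iff₀ (by positivity) (by positivity), one_mul]
  have h10 : (2 : ℝ) ≤ K ^ 10 := by
    have : (16 : ℝ) ^ 10 ≤ K ^ 10 := pow_le_pow_left₀ (by norm_num) hK 10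
    norm_num at this
    linarith
  calc 2 * K ^ 20 ≤ K ^ 10 * K ^ 20 := mul_le_mul_of_nonneg_right h10 (by positivity)
    _ = K ^ 30 := by ring

/-- `K ≥ K₀ = 2·20⁴²·42! + 16` is far above `1199⁴ ≈ 2.07·10¹²`. [folklore] -/
theorem K0_ge {K : ℝ} (hK : 2 * 20 ^ 42 * (Nat.factorial 42 : ℝ) + 16 ≤ K) : (1199 : ℝ) ^ 4 ≤ K := by
  have hfac : (1 : ℝ) ≤ (Nat.factorial 42 : ℝ) := by
    exact_mod_cast Nat.succ_le_of_lt (Nat.factorial_pos 42)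
  have h1 : (1199 : ℝ) ^ 4 ≤ 2 * 20 ^ 42 * 1 := by norm_num
  have h2 : (2 : ℝ) * 20 ^ 42 * 1 ≤ 2 * 20 ^ 42 * (Nat.factorial 42 : ℝ) :=
    mul_le_mul_of_nonneg_left hfac (by positivity)
  linarith

/-- `1/K + 300 log K/K ≤ 1/√K` once `K ≥ 1199⁴`: with `q = K^{1/4} ≥ 1199`, `log K = 4 log q ≤ 4(q - 1)`
and `1 + 1200(q - 1) ≤ q²` (`(q - 1)(q - 1199) ≥ 0`). So the delivery time `t_c + 880 log K/M + 1/K +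
300 log K/K` precedes the printed onset `t_c + 880 log K/M + 1/√K`. [folklore] -/
theorem inv_add_log_le_invSqrt {K : ℝ} (hK : (1199 : ℝ) ^ 4 ≤ K) :
    K⁻¹ + 300 * Real.log K / K ≤ (sqrt K)⁻¹ := by
  have hK0 : 0 < K := lt_of_lt_of_le (by norm_num) hK
  have hK16 : 16 ≤ K := le_trans (by norm_num) hK
  obtain ⟨-, -, hKs, -, -⟩ := invSqrt_facts hK16
  set q : ℝ := sqrt (sqrt K) with hq
  have hsq : sqrt K = q ^ 2 := by rw [hq, sq_sqrt (sqrt_nonneg K)]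
  have hK4 : K = q ^ 4 := by
    calc K = (sqrt K) ^ 2 := (sq_sqrt hK0.le).symm
      _ = q ^ 4 := by rw [hsq]; ring
  have hq1199 : 1199 ≤ q := by
    have h1 : sqrt ((1199 : ℝ) ^ 4) ≤ sqrt K := sqrt_le_sqrt hK
    have h2 : sqrt ((1199 : ℝ) ^ 4) = 1199 ^ 2 := by
      rw [show ((1199 : ℝ)) ^ 4 = (1199 ^ 2) ^ 2 by norm_num, sqrt_sq (by norm_num)]
    rw [h2] at h1
    have h3 : sqrt ((1199 : ℝ) ^ 2) ≤ sqrt (sqrt K) := sqrt_le_sqrt h1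
    rw [sqrt_sq (by norm_num)] at h3
    exact h3
  have hqpos : 0 < q := by linarith
  have hlog : Real.log K ≤ 4 * (q - 1) := by
    rw [hK4, Real.log_pow]
    push_cast
    have := Real.log_le_sub_one_of_pos hqpos
    linarith
  have key : 1 + 300 * Real.log K ≤ sqrt K := by
    calc 1 + 300 * Real.log K ≤ 1 + 1200 * (q - 1) := by linarith
      _ ≤ q ^ 2 := by
          nlinarith [mul_nonneg (sub_nonneg.2 (by linarith : (1 : ℝ) ≤ q)) (sub_nonneg.2 hq1199)]
      _ = sqrt K := hsq.symm
  have hsum : K⁻¹ + 300 * Real.log K / K = (1 + 300 * Real.log K) / K := by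
    field_simp
  have hKs' : (sqrt K)⁻¹ * K = sqrt K := by rw [mul_comm]; exact hKs
  rw [hsum, div_le_iff₀ hK0, hKs']
  exact key

/-- The smallness `ε ≤ e^{-700·M·log K/K}/K¹⁸⁰⁰` in the forms used: `ε ≤ 1`, `ε² ≤ 1/(6K²⁰)`, `ε ≤ K⁻¹⁰⁰`,
and the PULSE HYPOTHESIS at the delivery time, `T₀ - t_c = 880 log K/M + 1/K + 300 log K/K`:
`64·M·ε²·e^{4M(T₀ - t_c)} = 64·M·ε²·K³⁵²⁰·e^{4M/K}·K^{1200M/K} ≤ 64·M·K⁻⁸⁰·e^{(4 - 200 log K)M/K} ≤ K²⁰`.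
[folklore] -/
theorem eps_poly_facts {K M ε : ℝ} (hK : 16 ≤ K) (hM0 : 0 < M) (hMK : M ≤ K ^ 10) (hε : 0 < ε)
    (hεle : ε ≤ exp (-(700 * M * Real.log K / K)) / K ^ 1800) :
    ε ≤ 1 ∧ ε ^ 2 ≤ 1 / (6 * K ^ 20) ∧ ε ≤ 1 / K ^ 100 ∧
      64 * M * ε ^ 2 * exp (4 * M * (880 * Real.log K / M + K⁻¹ + 300 * Real.log K / K))
        ≤ K ^ 20 := by
  have hK0 : 0 < K := by linarith
  have hK1 : 1 ≤ K := by linarith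
  have hKne : K ≠ 0 := hK0.ne'
  have hMne : M ≠ 0 := hM0.ne'
  obtain ⟨hlog2, -, hlog0⟩ := log_facts hK
  have hexp1 : exp (-(700 * M * Real.log K / K)) ≤ 1 := by
    rw [exp_le_one_iff, neg_nonpos]; positivity
  have h1800 : ε ≤ 1 / K ^ 1800 := hεle.trans (div_le_div_of_nonneg_right hexp1 (by positivity))
  have h100 : ε ≤ 1 / K ^ 100 := h1800.trans (by
    apply div_le_div_of_nonneg_left (by norm_num) (by positivity)
    exact pow_le_pow_right₀ hK1 (by norm_num))
  have hK100 : (1 : ℝ) ≤ K ^ 100 := one_le_pow₀ hK1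
  have h1 : ε ≤ 1 := h100.trans (by rw [div_le_iff₀ (by positivity)]; linarith)
  refine ⟨h1, ?_, h100, ?_⟩
  · have h2 : ε ^ 2 ≤ (1 / K ^ 100) ^ 2 := pow_le_pow_left₀ hε.le h100 2
    refine h2.trans ?_
    rw [div_pow, one_pow, div_le_div_iff₀ (by positivity) (by positivity), one_mul, one_mul]
    calc 6 * K ^ 20 ≤ K ^ 180 * K ^ 20 := by
          have : (6 : ℝ) ≤ K ^ 180 := by
            have : (16 : ℝ) ^ 180 ≤ K ^ 180 := pow_le_pow_left₀ (by norm_num) hK 180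
            linarith
          exact mul_le_mul_of_nonneg_right this (by positivity)
      _ = (K ^ 100) ^ 2 := by ring
  · have hsq : ε ^ 2 ≤ exp (-(1400 * M * Real.log K / K)) / K ^ 3600 := by
      have h := pow_le_pow_left₀ hε.le hεle 2
      refine h.trans (le_of_eq ?_)
      rw [div_pow, ← Real.exp_nat_mul]
      congr 1
      · congr 1; push_cast; ring
      · ring
    have hE : exp (4 * M * (880 * Real.log K / M + K⁻¹ + 300 * Real.log K / K))
        = K ^ 3520 * exp (4 * M / K + 1200 * M * Real.log K / K) := by
      have : 4 * M * (880 * Real.log K / M + K⁻¹ + 300 * Real.log K / K)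
          = (3520 : ℕ) * Real.log K + (4 * M / K + 1200 * M * Real.log K / K) := by
        push_cast; field_simp; ring
      rw [this, exp_add, Real.exp_nat_mul, Real.exp_log hK0]
    rw [hE]
    have hcomb : exp (-(1400 * M * Real.log K / K)) * exp (4 * M / K + 1200 * M * Real.log K / K)
        = exp (M / K * (4 - 200 * Real.log K)) := by
      rw [← exp_add]; congr 1; field_simp; ring
    have hneg : exp (M / K * (4 - 200 * Real.log K)) ≤ 1 := by
      rw [exp_le_one_iff]
      have h4 : 4 - 200 * Real.log K ≤ 0 := by linarith
      have hMK0 : 0 ≤ M / K := by positivity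
      nlinarith
    have h64 : (64 : ℝ) ≤ K ^ 90 := by
      have : (16 : ℝ) ^ 90 ≤ K ^ 90 := pow_le_pow_left₀ (by norm_num) hK 90
      norm_num at this
      linarith
    calc 64 * M * ε ^ 2 * (K ^ 3520 * exp (4 * M / K + 1200 * M * Real.log K / K))
        ≤ 64 * M * (exp (-(1400 * M * Real.log K / K)) / K ^ 3600)
            * (K ^ 3520 * exp (4 * M / K + 1200 * M * Real.log K / K)) := by gcongr
      _ = 64 * M / K ^ 80 * (exp (-(1400 * M * Real.log K / K))
            * exp (4 * M / K + 1200 * M * Real.log K / K)) := by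
          field_simp
      _ = 64 * M / K ^ 80 * exp (M / K * (4 - 200 * Real.log K)) := by rw [hcomb]
      _ ≤ 64 * M / K ^ 80 * 1 := mul_le_mul_of_nonneg_left hneg (by positivity)
      _ ≤ K ^ 20 := by
          rw [mul_one, div_le_iff₀ (by positivity)]
          calc 64 * M ≤ K ^ 90 * K ^ 10 := mul_le_mul h64 hMK hM0.le (by positivity)
            _ = K ^ 20 * K ^ 80 := by ring

/-! ## Theorem 5.3 under the pulse hypothesis, and under the polynomial threshold -/

/-- **Theorem 5.3 for the family under the PULSE HYPOTHESIS.** For `K ≥ K₀`, `3000 log K ≤ M ≤ K¹⁰` and an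
amplitude `0 < ε` with `ε² ≤ 1/(6K²⁰)`, `ε ≤ K⁻¹⁰⁰` and `64·M·ε²·e^{4M(880 log K/M + 1/K + 300 log K/K)} ≤ K²⁰`:
the conclusion of Theorem 5.3 — `|t_c - √2| ≤ 24 log K/M`, (able) on `[0, t_c]`, (beable) for ALL
`t ≥ t_c + 880 log K/M + 1/K + 300 log K/K`, constants `200K⁻¹⁰`. [cite: Tao2016AveragedNS, Theorem 5.3, §5.5] -/
theorem transition_of_pulse {K M ε : ℝ} {X : ℝ → Fin 5 → ℝ}
    (hK : 2 * 20 ^ 42 * (Nat.factorial 42 : ℝ) + 16 ≤ K) (hML : 3000 * Real.log K ≤ M)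
    (hMK : M ≤ K ^ 10) (hε : 0 < ε) (hε1 : ε ≤ 1) (hεK : ε ^ 2 ≤ 1 / (6 * K ^ 20))
    (hε100 : ε ≤ 1 / K ^ 100)
    (hεT : 64 * M * ε ^ 2 * exp (4 * M * (880 * Real.log K / M + K⁻¹ + 300 * Real.log K / K))
      ≤ K ^ 20)
    (h0 : X 0 = delayInit) (hX : ∀ t, HasDerivAt X (delayCircuitWith K M ε (X t)) t) :
    ∃ tc : ℝ, |tc - Real.sqrt 2| ≤ 24 * Real.log K / M ∧
      (∀ t ∈ Set.Icc 0 tc,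
        |X t 0 - 1| ≤ 200 / K ^ 10 ∧ ∀ i : Fin 5, i ≠ 0 → |X t i| ≤ 200 / K ^ 10) ∧
      (∀ t, tc + 880 * Real.log K / M + 1 / K + 300 * Real.log K / K ≤ t →
        |X t 4 - 1| ≤ 200 / K ^ 10 ∧ ∀ i : Fin 5, i ≠ 4 → |X t i| ≤ 200 / K ^ 10) := by
  obtain ⟨hK16, hM0, hML48, hlog2, -, hδ, hon, hδle, h2M⟩ := family_params hK hML
  have hK0 : 0 < K := by linarith
  have hKM : exp (-M) ≤ 1 / K ^ 10 := exp_neg_le_inv_pow hK0 (by linarith)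
  -- the critical time: first hitting time of the level `K⁻¹⁰ε²` by `c` on `[0,2]`
  obtain ⟨τ, hτ0, hτ2, hcτ, hτeq⟩ := exists_hitTime (continuous_traj hX 2)
    (θ := ε ^ 2 / K ^ 10) (T := 2) two_pos (by rw [init_c h0]; positivity)
  obtain ⟨hlo, hhi, hτ1, hτ32, hcτeq⟩ :=
    tc_window hX h0 hε hε1 hM0 hMK hK16 hML48 hεK hτ0 hτ2 hcτ hτeq
  -- the delivery time `T₀ = t_c + δ + 1/K + L` fits inside `[0,2]`
  have hsK : K⁻¹ + 300 * Real.log K / K ≤ (sqrt K)⁻¹ := inv_add_log_le_invSqrt (K0_ge hK)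
  have hfit2 : τ + 880 * Real.log K / M + (sqrt K)⁻¹ ≤ 2 := window_fits hK16 hτ1 hhi h2M hδle
  have hT2 : τ + 880 * Real.log K / M + K⁻¹ + 300 * Real.log K / K ≤ 2 := by linarith
  have hεT' : 64 * M * ε ^ 2 *
      exp (4 * M * (τ + 880 * Real.log K / M + K⁻¹ + 300 * Real.log K / K - τ)) ≤ K ^ 20 := by
    have : τ + 880 * Real.log K / M + K⁻¹ + 300 * Real.log K / K - τ
        = 880 * Real.log K / M + K⁻¹ + 300 * Real.log K / K := by ring
    rw [this]; exact hεT
  have hL : 0 ≤ 300 * Real.log K / K := div_nonneg (by linarith) hK0.le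
  have hN4 := drain_numeric hK16
  refine ⟨τ, abs_sub_sqrt_two_le hτ1 (div_nonneg (by linarith) hM0.le)
      (div_le_div_of_nonneg_right (by linarith) hM0.le) hlo hhi, ?_, ?_⟩
  · -- (able), on all of `[0, t_c]`
    intro t ht
    exact able_window hX h0 hε hε1 hM0.le hK16 hεK hε100 hτ2 hcτ ht
  · -- (beable), for all later times
    intro t ht
    rw [one_div] at ht
    have ht0 : 0 ≤ t := by
      have : 0 < K⁻¹ := inv_pos.2 hK0
      linarith
    exact beable_of_sum_sq hX h0 hK16 ht0
      (sum_sq_after hX h0 hε hε1 hM0 hMK hK16 hεK hε100 hKM hδ hon hL hN4 hτ1 le_rfl hT2 hεT'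
        hcτ hcτeq ht)

/-- **Theorem 5.3 for the family under the POLYNOMIAL amplitude threshold** `ε ≤ e^{-700·M·log K/K}/K¹⁸⁰⁰`
(tree: `e^{-10M}/K¹⁰⁰`, `Thm53With.transitionWith_explicit`): for `K ≥ K₀ = 2·20⁴²·42! + 16`,
`3000 log K ≤ M ≤ K¹⁰` and every trajectory of `delayCircuitWith K M ε` from `delayInit` — `|t_c - √2| ≤
24 log K/M`, (able) on `[0, t_c]`, (beable) for all `t ≥ t_c + 880 log K/M + 1/K + 300 log K/K`, constants
`200K⁻¹⁰`. [cite: Tao2016AveragedNS, Theorem 5.3, §5.5] -/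
theorem transition_polyThreshold {K M ε : ℝ} {X : ℝ → Fin 5 → ℝ}
    (hK : 2 * 20 ^ 42 * (Nat.factorial 42 : ℝ) + 16 ≤ K) (hML : 3000 * Real.log K ≤ M)
    (hMK : M ≤ K ^ 10) (hε : 0 < ε) (hεle : ε ≤ exp (-(700 * M * Real.log K / K)) / K ^ 1800)
    (h0 : X 0 = delayInit) (hX : ∀ t, HasDerivAt X (delayCircuitWith K M ε (X t)) t) :
    ∃ tc : ℝ, |tc - Real.sqrt 2| ≤ 24 * Real.log K / M ∧
      (∀ t ∈ Set.Icc 0 tc,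
        |X t 0 - 1| ≤ 200 / K ^ 10 ∧ ∀ i : Fin 5, i ≠ 0 → |X t i| ≤ 200 / K ^ 10) ∧
      (∀ t, tc + 880 * Real.log K / M + 1 / K + 300 * Real.log K / K ≤ t →
        |X t 4 - 1| ≤ 200 / K ^ 10 ∧ ∀ i : Fin 5, i ≠ 4 → |X t i| ≤ 200 / K ^ 10) := by
  obtain ⟨hK16, hM0, -⟩ := family_params hK hML
  obtain ⟨hε1, hεK, hε100, hεT⟩ := eps_poly_facts hK16 hM0 hMK hε hεle
  exact transition_of_pulse hK hML hMK hε hε1 hεK hε100 hεT h0 hX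

/-- The same with the PRINTED onset `t_c + 880 log K/M + 1/√K` of the fired window (the shape of
`Thm53With.transitionWith_explicit`, since `1/K + 300 log K/K ≤ 1/√K`). [cite: Tao2016AveragedNS, Theorem 5.3] -/
theorem transition_polyThreshold_sqrt {K M ε : ℝ} {X : ℝ → Fin 5 → ℝ}
    (hK : 2 * 20 ^ 42 * (Nat.factorial 42 : ℝ) + 16 ≤ K) (hML : 3000 * Real.log K ≤ M)
    (hMK : M ≤ K ^ 10) (hε : 0 < ε) (hεle : ε ≤ exp (-(700 * M * Real.log K / K)) / K ^ 1800)
    (h0 : X 0 = delayInit) (hX : ∀ t, HasDerivAt X (delayCircuitWith K M ε (X t)) t) :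
    ∃ tc : ℝ, |tc - Real.sqrt 2| ≤ 24 * Real.log K / M ∧
      (∀ t ∈ Set.Icc 0 tc,
        |X t 0 - 1| ≤ 200 / K ^ 10 ∧ ∀ i : Fin 5, i ≠ 0 → |X t i| ≤ 200 / K ^ 10) ∧
      (∀ t, tc + 880 * Real.log K / M + 1 / Real.sqrt K ≤ t →
        |X t 4 - 1| ≤ 200 / K ^ 10 ∧ ∀ i : Fin 5, i ≠ 4 → |X t i| ≤ 200 / K ^ 10) := by
  obtain ⟨tc, htc, hearly, hlate⟩ := transition_polyThreshold hK hML hMK hε hεle h0 hX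
  have hsK : K⁻¹ + 300 * Real.log K / K ≤ (sqrt K)⁻¹ := inv_add_log_le_invSqrt (K0_ge hK)
  refine ⟨tc, htc, hearly, fun t ht => hlate t ?_⟩
  rw [one_div] at ht ⊢
  linarith

/-- **A fixed power of `K` suffices for every amplifier up to `M ≤ K/(700 log K)`**: if moreover
`700·M·log K ≤ K`, then `0 < ε ≤ K⁻¹⁸⁰¹` gives the conclusion of Theorem 5.3 (`e^{-700·M·log K/K} ≥ e⁻¹ >
1/K`). The tree's `polySeedTransition` (`M = p log K`) needs `ε ≤ K^{-(10p+100)}`, degree `≥ 30100`.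
[cite: Tao2016AveragedNS, Theorem 5.3, §5.5] -/
theorem transition_linearAmplifier {K M ε : ℝ} {X : ℝ → Fin 5 → ℝ}
    (hK : 2 * 20 ^ 42 * (Nat.factorial 42 : ℝ) + 16 ≤ K) (hML : 3000 * Real.log K ≤ M)
    (hMlin : 700 * M * Real.log K ≤ K) (hε : 0 < ε) (hεle : ε ≤ 1 / K ^ 1801)
    (h0 : X 0 = delayInit) (hX : ∀ t, HasDerivAt X (delayCircuitWith K M ε (X t)) t) :
    ∃ tc : ℝ, |tc - Real.sqrt 2| ≤ 24 * Real.log K / M ∧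
      (∀ t ∈ Set.Icc 0 tc,
        |X t 0 - 1| ≤ 200 / K ^ 10 ∧ ∀ i : Fin 5, i ≠ 0 → |X t i| ≤ 200 / K ^ 10) ∧
      (∀ t, tc + 880 * Real.log K / M + 1 / K + 300 * Real.log K / K ≤ t →
        |X t 4 - 1| ≤ 200 / K ^ 10 ∧ ∀ i : Fin 5, i ≠ 4 → |X t i| ≤ 200 / K ^ 10) := by
  obtain ⟨hK16, hM0, -, hlog2, -⟩ := family_params hK hML
  have hK0 : 0 < K := by linarith
  have hK1 : 1 ≤ K := by linarith
  -- `M ≤ K/(700 log K) ≤ K¹⁰`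
  have hMK : M ≤ K ^ 10 := by
    have h1 : M ≤ 700 * M * Real.log K := by nlinarith
    exact h1.trans (hMlin.trans (le_self_pow₀ hK1 (by norm_num)))
  -- `K⁻¹⁸⁰¹ ≤ e^{-700·M·log K/K}/K¹⁸⁰⁰`
  have hx1 : 700 * M * Real.log K / K ≤ 1 := by rwa [div_le_one hK0]
  have hexp : 1 / K ≤ exp (-(700 * M * Real.log K / K)) := by
    have h1 : exp (-1) ≤ exp (-(700 * M * Real.log K / K)) := exp_le_exp.2 (by linarith)
    have h2 := Real.exp_neg_one_gt_d9
    have h3 : 1 / K ≤ 1 / 16 := by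
      apply div_le_div_of_nonneg_left (by norm_num) (by norm_num) hK16
    linarith
  have hεle' : ε ≤ exp (-(700 * M * Real.log K / K)) / K ^ 1800 := by
    refine hεle.trans ?_
    rw [show (1 : ℝ) / K ^ 1801 = 1 / K / K ^ 1800 by rw [pow_succ, div_div, mul_comm]]
    exact div_le_div_of_nonneg_right hexp (by positivity)
  exact transition_polyThreshold hK hML hMK hε hεle' h0 hX

/-- **Tao's own circuit (5.5)** (`M = K¹⁰`, `delayCircuitWith_pow_ten`): Theorem 5.3 with the printed boxes
holds already for `0 < ε ≤ e^{-700K⁹log K}/K¹⁸⁰⁰` (the tree's `DelayedAbruptTransition_holds` certifies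
`ε ≤ e^{-10K¹⁰}/K¹⁰⁰`): `|t_c - √2| ≤ 24 log K/K¹⁰`, (able) on `[0, t_c]`, (beable) for all
`t ≥ t_c + 880 log K/K¹⁰ + 1/K + 300 log K/K`. [cite: Tao2016AveragedNS, Theorem 5.3, §5.5] -/
theorem taoMember_polyPulse {K ε : ℝ} {X : ℝ → Fin 5 → ℝ}
    (hK : 2 * 20 ^ 42 * (Nat.factorial 42 : ℝ) + 16 ≤ K) (hε : 0 < ε)
    (hεle : ε ≤ exp (-(700 * K ^ 9 * Real.log K)) / K ^ 1800)
    (h0 : X 0 = delayInit) (hX : ∀ t, HasDerivAt X (delayCircuit K ε (X t)) t) :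
    ∃ tc : ℝ, |tc - Real.sqrt 2| ≤ 24 * Real.log K / K ^ 10 ∧
      (∀ t ∈ Set.Icc 0 tc,
        |X t 0 - 1| ≤ 200 / K ^ 10 ∧ ∀ i : Fin 5, i ≠ 0 → |X t i| ≤ 200 / K ^ 10) ∧
      (∀ t, tc + 880 * Real.log K / K ^ 10 + 1 / K + 300 * Real.log K / K ≤ t →
        |X t 4 - 1| ≤ 200 / K ^ 10 ∧ ∀ i : Fin 5, i ≠ 4 → |X t i| ≤ 200 / K ^ 10) := by
  have hB : (0 : ℝ) ≤ 2 * 20 ^ 42 * (Nat.factorial 42 : ℝ) := by positivity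
  have hK16 : 16 ≤ K := by linarith
  have hK0 : 0 < K := by linarith
  have hK1 : 1 ≤ K := by linarith
  have hX' : ∀ t, HasDerivAt X (delayCircuitWith K (K ^ 10) ε (X t)) t := by
    intro t; rw [delayCircuitWith_pow_ten]; exact hX t
  -- `3000 log K ≤ K¹⁰`: `log K ≤ K` and `3000K ≤ K¹⁰`
  have hML : 3000 * Real.log K ≤ K ^ 10 := by
    have h1 : Real.log K ≤ K := (Real.log_le_sub_one_of_pos hK0).trans (by linarith)
    have h9 : (3000 : ℝ) ≤ K ^ 9 := by
      have : (16 : ℝ) ^ 9 ≤ K ^ 9 := pow_le_pow_left₀ (by norm_num) hK16 9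
      norm_num at this
      linarith
    have hl0 : 0 ≤ Real.log K := Real.log_nonneg hK1
    calc 3000 * Real.log K ≤ K ^ 9 * K := mul_le_mul h9 h1 hl0 (by positivity)
      _ = K ^ 10 := by ring
  have hεle' : ε ≤ exp (-(700 * K ^ 10 * Real.log K / K)) / K ^ 1800 := by
    have : 700 * K ^ 10 * Real.log K / K = 700 * K ^ 9 * Real.log K := by
      field_simp
    rw [this]; exact hεle
  exact transition_polyThreshold hK hML le_rfl hε hεle' h0 hX'

end Summit.NavierStokesRegularity.FluidComputer.AmplitudeKnob
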